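import Mathlib.Topology.JacobsonSpace
import Mathlib.AlgebraicGeometry.Morphisms.FiniteType
import Mathlib.AlgebraicGeometry.Noetherian
import Summits.ResolutionOfSingularities.ResolutionOfSingularities.Theorems.FrobeniusLadderFInjectiveMacaulayficationClauseLocalizesScheme
import Summits.ResolutionOfSingularities.ResolutionOfSingularities.Theorems.FrobeniusLadderFInjectiveMacaulayficationDegreeZeroDescentLocal
import Summits.ResolutionOfSingularities.ResolutionOfSingularities.Theorems.FInjectiveMacaulayfication.Negative.LoadBearing
import HarnessLib

/-!
# The bad points of a Cohen–Macaulay scheme with finitely many non-F-injective stalks are closed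

Support file for crux stmt-ResolutionOfSingularities-15315 (`FrobeniusLadder.FInjectiveMacaulayfication`,
line `isolation`; stub `stub_badPointsClosed`, landed by the lead of the sibling line `Sketch`, seat c6,
cycle 7 wave 3).

Setting: `X₁` locally of finite type over a field `k` of characteristic `p`, every stalk Cohen–Macaulay
(every system of parameters weakly regular), and the BAD set — the points `x` at which some system of
parameters of `𝒪_{X₁,x}` generates an ideal that is not Frobenius closed (inline form
`(∃ e, y^(p^e) ∈ span {z^(p^e) | z ∈ (s)}) → y ∈ (s)` fails) — finite. Claim: every bad point `b` is a
closed point (`stub_badPointsClosed`), so that the bad locus is a finite set of closed points at which the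
line's point-centred surgery can be performed.

Proof (no dimension theory). The clause GENERIZES (`clause_of_specializes`): if `b ⤳ x` and the
Cohen–Macaulay + Frobenius-closed clause holds at `𝒪_{X₁,x}` then it holds at `𝒪_{X₁,b}`, because
`𝒪_{X₁,b}` is the localization of `𝒪_{X₁,x}` at a prime (`isLocalizationAtPrime_stalkSpecializes`,
Stacks 01J7), the clause localizes (E5, `ClauseLocalizes.clause_localization`) and transports along ring
isomorphisms (`DegreeZeroDescent.inlineClause_of_ringEquiv`); the stalks are Noetherian
(`LocallyOfFiniteType.isLocallyNoetherian`) of characteristic `p` (`Negative.charP_stalk`). Hence every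
specialization of a bad point is bad: `closure {b}` lies in the bad set and is FINITE. Finally `X₁` is a
Jacobson space (`LocallyOfFiniteType.jacobsonSpace`), and in a Jacobson space a point with finite closure
is closed (`isClosed_singleton_of_finite_closure`): `Z = closure {b}` satisfies
`closure (Z ∩ closedPoints) = Z`, while `Z ∩ closedPoints` is a finite union of closed singletons, hence
closed; so `b ∈ Z = Z ∩ closedPoints`.

References: folklore over Mathlib's `JacobsonSpace` API and the line's engine E5; no definition is
declared. [folklore]
-/

-- single-problem summit: the doubled namespace component `ResolutionOfSingularities` is forced
set_option linter.dupNamespace false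

noncomputable section

namespace Summit.ResolutionOfSingularities.ResolutionOfSingularities.Theorems.FInjectiveMacaulayfication.BadPointsClosed

open CategoryTheory AlgebraicGeometry IsLocalRing RingTheory.Sequence Literature.AlgebraicGeometry.Resolution

/-! ## §1 Topology: in a Jacobson space a point with finite closure is closed -/

/-- **In a Jacobson space a point with finite closure is closed.** For `Z = closure {b}` the Jacobson
property gives `closure (Z ∩ closedPoints X) = Z`; `Z ∩ closedPoints X` is a finite union of closed
singletons, hence closed, so `Z = Z ∩ closedPoints X ∋ b`. [folklore] -/
theorem isClosed_singleton_of_finite_closure {X : Type*} [TopologicalSpace X] [JacobsonSpace X] {b : X}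
    (h : (closure ({b} : Set X)).Finite) : IsClosed ({b} : Set X) := by
  have hC : IsClosed (closure ({b} : Set X) ∩ closedPoints X) := by
    rw [← (closure ({b} : Set X) ∩ closedPoints X).biUnion_of_singleton]
    exact (h.subset Set.inter_subset_left).isClosed_biUnion fun x hx => hx.2
  have hEq : closure ({b} : Set X) ∩ closedPoints X = closure ({b} : Set X) := by
    have h1 := closure_inter_closedPoints (X := X) (Z := closure ({b} : Set X)) isClosed_closure
    rwa [hC.closure_eq] at h1
  have hb : b ∈ closure ({b} : Set X) ∩ closedPoints X := by
    rw [hEq]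
    exact subset_closure rfl
  exact hb.2

/-- **A finite set stable under specialization in a Jacobson space consists of closed points.**
[folklore] -/
theorem isClosed_singleton_of_stableUnderSpecialization_finite {X : Type*} [TopologicalSpace X]
    [JacobsonSpace X] {B : Set X} (hB : B.Finite) (hstab : StableUnderSpecialization B) {b : X}
    (hb : b ∈ B) : IsClosed ({b} : Set X) := by
  refine isClosed_singleton_of_finite_closure (hB.subset fun x hx => ?_)
  exact hstab (specializes_iff_mem_closure.mpr hx) hb

/-! ## §2 The Cohen–Macaulay + Frobenius-closed clause generizes -/

/-- **From a specialization to the point (no domain conjunct)**: in a locally Noetherian scheme, if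
`x ⤳ y`, the stalk at `y` has characteristic `p` and satisfies the Cohen–Macaulay + Frobenius-closed clause
(every system of parameters weakly regular and generating a Frobenius closed ideal), then so does the stalk at
`x`: `𝒪_{X,x}` is the localization of `𝒪_{X,y}` at a prime (`isLocalizationAtPrime_stalkSpecializes`,
Stacks 01J7), the clause localizes (`ClauseLocalizes.clause_localization`, E5) and transports along ring
isomorphisms (`DegreeZeroDescent.inlineClause_of_ringEquiv`). [folklore] -/
theorem clause_of_specializes (p : ℕ) [Fact p.Prime] {X : Scheme.{0}} [IsLocallyNoetherian X] {x y : X}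
    (hxy : x ⤳ y) [CharP (X.presheaf.stalk y) p]
    (hy : ∀ d : ℕ, ringKrullDim (X.presheaf.stalk y) = d →
      ∀ s : Fin d → X.presheaf.stalk y, (Ideal.span (Set.range s)).radical.IsMaximal →
        IsWeaklyRegular (X.presheaf.stalk y) (List.ofFn s) ∧
        ∀ z : X.presheaf.stalk y, (∃ e : ℕ, z ^ p ^ e ∈ Ideal.span
          ((fun w : X.presheaf.stalk y => w ^ p ^ e) ''
            (Ideal.span (Set.range s) : Set (X.presheaf.stalk y)))) → z ∈ Ideal.span (Set.range s)) :
    ∀ d : ℕ, ringKrullDim (X.presheaf.stalk x) = d →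
      ∀ s : Fin d → X.presheaf.stalk x, (Ideal.span (Set.range s)).radical.IsMaximal →
        IsWeaklyRegular (X.presheaf.stalk x) (List.ofFn s) ∧
        ∀ z : X.presheaf.stalk x, (∃ e : ℕ, z ^ p ^ e ∈ Ideal.span
          ((fun w : X.presheaf.stalk x => w ^ p ^ e) ''
            (Ideal.span (Set.range s) : Set (X.presheaf.stalk x)))) → z ∈ Ideal.span (Set.range s) := by
  letI := (X.presheaf.stalkSpecializes hxy).hom.toAlgebra
  set P := (maximalIdeal (X.presheaf.stalk x)).comap (X.presheaf.stalkSpecializes hxy).hom with hP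
  haveI hloc : IsLocalization.AtPrime (X.presheaf.stalk x) P := isLocalizationAtPrime_stalkSpecializes hxy
  have hPloc := ClauseLocalizes.clause_localization p hy P
  -- `𝒪_{X,x} ≅ (𝒪_{X,y})_P` as rings
  let e : Localization.AtPrime P ≃+* X.presheaf.stalk x :=
    (IsLocalization.algEquiv P.primeCompl (Localization.AtPrime P) (X.presheaf.stalk x)).toRingEquiv
  exact DegreeZeroDescent.inlineClause_of_ringEquiv p e hPloc

/-! ## §3 Bad points are closed -/

/-- **Bad points are closed.** Let `X` be locally of finite type over a field of characteristic `p` with all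
stalks Cohen–Macaulay, and suppose the set of points whose stalk has a system of parameters generating a
non-Frobenius-closed ideal is finite. Then every such point is closed: by `clause_of_specializes` the bad
set is stable under specialization (`X` is locally Noetherian, stalks have characteristic `p`), and a finite
specialization-stable set in the Jacobson space `X` consists of closed points. [folklore] -/
theorem isClosed_singleton_of_not_clause {p : ℕ} (hp : p.Prime) {k : Type} [Field k] [CharP k p]
    {X : Scheme.{0}} (f : X ⟶ Spec (.of k)) [LocallyOfFiniteType f]
    (hCM : ∀ x : X, ∀ d : ℕ, ringKrullDim (X.presheaf.stalk x) = d → ∀ s : Fin d → X.presheaf.stalk x,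
      (Ideal.span (Set.range s)).radical.IsMaximal → IsWeaklyRegular (X.presheaf.stalk x) (List.ofFn s))
    (hfin : Set.Finite {x : X | ¬ ∀ d : ℕ, ringKrullDim (X.presheaf.stalk x) = d →
      ∀ s : Fin d → X.presheaf.stalk x, (Ideal.span (Set.range s)).radical.IsMaximal →
        ∀ y : X.presheaf.stalk x, (∃ e : ℕ, y ^ p ^ e ∈ Ideal.span
          ((fun z : X.presheaf.stalk x => z ^ p ^ e) ''
            (Ideal.span (Set.range s) : Set (X.presheaf.stalk x)))) → y ∈ Ideal.span (Set.range s)})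
    {b : X} (hb : ¬ ∀ d : ℕ, ringKrullDim (X.presheaf.stalk b) = d →
      ∀ s : Fin d → X.presheaf.stalk b, (Ideal.span (Set.range s)).radical.IsMaximal →
        ∀ y : X.presheaf.stalk b, (∃ e : ℕ, y ^ p ^ e ∈ Ideal.span
          ((fun z : X.presheaf.stalk b => z ^ p ^ e) ''
            (Ideal.span (Set.range s) : Set (X.presheaf.stalk b)))) → y ∈ Ideal.span (Set.range s)) :
    IsClosed ({b} : Set X) := by
  haveI : Fact p.Prime := ⟨hp⟩
  haveI : JacobsonSpace X := LocallyOfFiniteType.jacobsonSpace f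
  haveI : IsLocallyNoetherian X := LocallyOfFiniteType.isLocallyNoetherian f
  refine isClosed_singleton_of_stableUnderSpecialization_finite hfin ?_ hb
  -- the bad set is stable under specialization: the clause generizes
  intro b' x hb'x hb'
  rw [Set.mem_setOf_eq] at hb' ⊢
  intro hx
  haveI : CharP (X.presheaf.stalk x) p := Negative.charP_stalk hp.ne_zero f x
  exact hb' fun d hd s hs =>
    (clause_of_specializes p hb'x (fun d' hd' s' hs' => ⟨hCM x d' hd' s' hs', hx d' hd' s' hs'⟩) d hd s hs).2

/-! ## Registered form -/

/-- **Bad points are closed, registered helper-stub form** (fully explicit binders; =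
`isClosed_singleton_of_not_clause`): for `X₁` locally of finite type (and quasi-compact — unused) over a
field of characteristic `p` with Cohen–Macaulay stalks and finitely many points at which some parameter
ideal is not Frobenius closed, every such point is closed. [folklore] -/
theorem stub_badPointsClosed : ∀ (p : ℕ), p.Prime → ∀ (k : Type) [Field k] [CharP k p] (X₁ : Scheme.{0}) (f₁ : X₁ ⟶ Spec (.of k)),
    LocallyOfFiniteType f₁ → QuasiCompact f₁ →
    (∀ x : X₁, ∀ d : ℕ, ringKrullDim (X₁.presheaf.stalk x) = d → ∀ s : Fin d → X₁.presheaf.stalk x, (Ideal.span (Set.range s)).radical.IsMaximal → RingTheory.Sequence.IsWeaklyRegular (X₁.presheaf.stalk x) (List.ofFn s)) →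
    Set.Finite {x : X₁ | ¬ ∀ d : ℕ, ringKrullDim (X₁.presheaf.stalk x) = d → ∀ s : Fin d → X₁.presheaf.stalk x, (Ideal.span (Set.range s)).radical.IsMaximal → ∀ y : X₁.presheaf.stalk x, (∃ e : ℕ, y ^ p ^ e ∈ Ideal.span ((fun z : X₁.presheaf.stalk x => z ^ p ^ e) '' (Ideal.span (Set.range s) : Set (X₁.presheaf.stalk x)))) → y ∈ Ideal.span (Set.range s)} →
    ∀ b : X₁, (¬ ∀ d : ℕ, ringKrullDim (X₁.presheaf.stalk b) = d → ∀ s : Fin d → X₁.presheaf.stalk b, (Ideal.span (Set.range s)).radical.IsMaximal → ∀ y : X₁.presheaf.stalk b, (∃ e : ℕ, y ^ p ^ e ∈ Ideal.span ((fun z : X₁.presheaf.stalk b => z ^ p ^ e) '' (Ideal.span (Set.range s) : Set (X₁.presheaf.stalk b)))) → y ∈ Ideal.span (Set.range s)) → IsClosed ({b} : Set X₁) :=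
  fun _ hp _ _ _ _ f₁ hf _ hCM hfin _ hb => by
    haveI := hf
    exact isClosed_singleton_of_not_clause hp f₁ hCM hfin hb

end Summit.ResolutionOfSingularities.ResolutionOfSingularities.Theorems.FInjectiveMacaulayfication.BadPointsClosed

end
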